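import Mathlib
import Summits.NavierStokesRegularity.NavierStokesRegularity.Theorems.LerayQuarterDissipationFiniteDissipationLiouvilleLocalBalanceStretchingEventualTools
import HarnessLib

/-!
# Crux `FiniteDissipationLiouville` (stmt-NavierStokesRegularity-22144): THE STRETCHING-FORM LOCAL BALANCE,
# EVENTUAL VERSIONS, file B — near the apex it forbids the singularity, in the far past it forces `V ≡ 0`

Theorems file of route `LerayQuarterDissipation` (lead prover g18; `--supports` the crux; sequel of
`…LocalBalanceStretching(Tools)`, `…EndpointSchemeApex`, `…EndpointSchemeFarPast`; companion of
`…LocalBalanceApex/…LocalBalanceFarPast`, which treat the Lamb form). Navier–Stokes regularity is NOT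
proved by anything here; no summit is.

Hypothesis (physical): `⟪ω, ∇u ω⟫ ≤ |∇ω|²_F + ‖ω‖²/(4(−t))` (vortex stretching ≤ local dissipation + the
scale-invariant quarter of `‖ω‖²/(−t)`), for a KNSS-gauge Type-I field with a Type-I envelope.

* `eq_zero_of_stretchingBalance_of_enstrophy_const` — the rigidity half of `…LocalBalanceStretching`
  isolated: all-time stretching balance + constant enstrophy ⇒ `V ≡ 0`;
* **`not_singular_of_stretchingBalance_near_apex`** — the hypothesis on `[τ,0) × ℝ³` (some `τ < 0`)
  forbids the apex singularity (`…EndpointSchemeApex`); **`eq_zero_of_stretchingBalance_farPast`** — on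
  `(−∞,τ] × ℝ³` it forces `V ≡ 0` (`…EndpointSchemeFarPast`);
* PORTRAITS `stretching_excess_accumulates_of_singular` (for every `τ < 0` a point `t ∈ [τ,0)` with
  `|∇ω|²_F + ‖ω‖²/(4(−t)) < ⟪ω, ∇V ω⟫`), `stretching_excess_recedes_of_ne_zero`.

HONEST FRAMING. Time-local / eventual forms of a law-free threshold about a HYPOTHETICAL object; for
the scaling-recurrent critical element nothing beyond the all-time clause follows. Nothing is removed
from the DSS wall. Nothing here bears on Navier–Stokes regularity.

References: Koch–Nadirashvili–Seregin–Šverák, Acta Math. 203 (2009) §4; Majda–Bertozzi (2002) §1.2.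
-/

noncomputable section

set_option linter.dupNamespace false

namespace Summit.NavierStokesRegularity.NavierStokesRegularity.Theorems.FiniteDissipationLiouville.LocalBalance

open MeasureTheory Set Filter Topology Metric InnerProductSpace Function Real
open scoped RealInnerProductSpace ContDiff
open Literature.Analysis Literature.Analysis.FluidPDE
open Summit.NavierStokesRegularity.NavierStokesRegularity.Theorems
open Summit.NavierStokesRegularity.NavierStokesRegularity.Theorems.GaussianGap
open Summit.NavierStokesRegularity.NavierStokesRegularity.Theorems.SimilarityEnstrophy
open Summit.NavierStokesRegularity.NavierStokesRegularity.Theorems.RecurrentReductionD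
open Summit.NavierStokesRegularity.NavierStokesRegularity.Theorems.FiniteDissipationLiouville
open Summit.NavierStokesRegularity.NavierStokesRegularity.Theorems.FiniteDissipationLiouville.CrossFlow
open Summit.NavierStokesRegularity.NavierStokesRegularity.Theorems.FiniteDissipationLiouville.EndpointScheme
open Summit.NavierStokesRegularity.NavierStokesRegularity.Theorems.FiniteDissipationLiouville.LambProduct

variable {C : ℝ} {V : ℝ → EuclideanSpace ℝ (Fin 3) → EuclideanSpace ℝ (Fin 3)}

/-- **Constant enstrophy + the all-time stretching balance kill an enveloped member** (the rigidity half
of `…LocalBalanceStretching.eq_zero_of_stretchingBalance`, isolated for the eventual schemes): the balance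
density `|∇Ω|²_F + ¼‖Ω‖² − ⟪Ω, ∇U Ω⟫ ≥ 0` integrates to `−½Z' = 0`, so it vanishes identically; far out
`‖∇U‖ < ¼` (class-uniform KNSS gradient decay) forces `Ω = 0`, hence everywhere by analyticity; the gauge
kills the irrotational field. [folklore energy method] -/
theorem eq_zero_of_stretchingBalance_of_enstrophy_const
    {F : ℝ → EuclideanSpace ℝ (Fin 3) → EuclideanSpace ℝ (Fin 3)}
    (hF : IsTypeIAncientMild C F) (hdF : HasTypeIDecay C F)
    (hPF : ∀ t < 0, ∀ x, ⟪curl (F t) x, fderiv ℝ (F t) x (curl (F t) x)⟫ ≤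
      1 * (frobeniusNormSq (fderiv ℝ (curl (F t)) x) + ‖curl (F t) x‖ ^ 2 / (4 * (-t))))
    (hconst : ∀ s s' : ℝ, (∫ y, ‖lerayVorticity F s y‖ ^ 2) = ∫ y, ‖lerayVorticity F s' y‖ ^ 2) :
    ∀ t < 0, ∀ x, F t x = 0 := by
  obtain ⟨K₁, hK₁0, hK₁⟩ :=
    IsTypeIAncientMild.exists_forall_pow_mul_norm_iteratedFDeriv_le_of_hasTypeIDecay 1 C
  obtain ⟨C₁, C₂, C₃, hD1, hD2, hD3⟩ := IsTypeIAncientMild.gaugeBounds_of_hasTypeIDecay hF hdF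
  have hΩ0 : ∀ s y, lerayVorticity F s y = 0 := by
    intro s
    have hd := similarityEnstrophy_hasDerivAt hF hD1 hD2 hD3 s
    have hc : HasDerivAt (fun σ => ∫ y, ‖lerayVorticity F σ y‖ ^ 2) 0 s := by
      have : (fun σ => ∫ y, ‖lerayVorticity F σ y‖ ^ 2) =
          fun _ => ∫ y, ‖lerayVorticity F 0 y‖ ^ 2 := funext fun σ => hconst σ 0
      rw [this]; exact hasDerivAt_const _ _
    have h0 := hd.unique hc
    have iF := integrable_frobeniusNormSq_fderiv_lerayVorticity hF hD2 s
    have iZ := integrable_norm_lerayVorticity_sq hF hD1 s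
    have iS := integrable_inner_stretching_lerayVorticity hF hD1 s
    -- the balance density `e = |∇Ω|² + ¼‖Ω‖² − ⟪Ω, ∇U Ω⟫ ≥ 0` has integral `0`
    have iZ' : Integrable fun y => (1 / 4 : ℝ) * ‖lerayVorticity F s y‖ ^ 2 := iZ.const_mul _
    have iFZ : Integrable fun y => frobeniusNormSq (fderiv ℝ (lerayVorticity F s) y) +
        (1 / 4 : ℝ) * ‖lerayVorticity F s y‖ ^ 2 := iF.add iZ'
    have iE : Integrable fun y => frobeniusNormSq (fderiv ℝ (lerayVorticity F s) y) +
        (1 / 4) * ‖lerayVorticity F s y‖ ^ 2 -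
        ⟪lerayVorticity F s y, fderiv ℝ (lerayOrbit F s) y (lerayVorticity F s y)⟫ := iFZ.sub iS
    have hE0 : ∫ y, (frobeniusNormSq (fderiv ℝ (lerayVorticity F s) y) +
        (1 / 4) * ‖lerayVorticity F s y‖ ^ 2 -
        ⟪lerayVorticity F s y, fderiv ℝ (lerayOrbit F s) y (lerayVorticity F s y)⟫) = 0 := by
      rw [integral_sub iFZ iS, integral_add iF iZ', integral_const_mul]
      linarith
    have hnn : ∀ y, 0 ≤ frobeniusNormSq (fderiv ℝ (lerayVorticity F s) y) +
        (1 / 4) * ‖lerayVorticity F s y‖ ^ 2 -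
        ⟪lerayVorticity F s y, fderiv ℝ (lerayOrbit F s) y (lerayVorticity F s y)⟫ := fun y => by
      have h := stretchingBalance_sim_of_phys hPF s y
      rw [one_mul] at h
      linarith
    have hΩinf := contDiff_lerayVorticity_slice hF s
    have hUc := contDiff_lerayOrbit_slice_of_typeI hF s (n := 1) (by norm_cast)
    have hcont : Continuous fun y => frobeniusNormSq (fderiv ℝ (lerayVorticity F s) y) +
        (1 / 4) * ‖lerayVorticity F s y‖ ^ 2 -
        ⟪lerayVorticity F s y, fderiv ℝ (lerayOrbit F s) y (lerayVorticity F s y)⟫ :=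
      ((continuous_frobeniusNormSq'.comp (hΩinf.continuous_fderiv (by simp))).add
        (continuous_const.mul (hΩinf.continuous.norm.pow 2))).sub
        (hΩinf.continuous.inner ((hUc.continuous_fderiv (by simp)).clm_apply hΩinf.continuous))
    have hae := (integral_eq_zero_iff_of_nonneg hnn iE).1 hE0
    have hev := (hcont.ae_eq_iff_eq (μ := volume) continuous_const).1 hae
    -- far field: `‖∇U‖ < ¼` outside the ball of radius `2√K₁`, so `Ω = 0` there
    refine lerayVorticity_eq_zero_of_eqOn_far hF s (R := 2 * Real.sqrt K₁) fun y hy => ?_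
    have heq : frobeniusNormSq (fderiv ℝ (lerayVorticity F s) y) + (1 / 4) * ‖lerayVorticity F s y‖ ^ 2 ≤
        ⟪lerayVorticity F s y, fderiv ℝ (lerayOrbit F s) y (lerayVorticity F s y)⟫ := by
      have h1 : frobeniusNormSq (fderiv ℝ (lerayVorticity F s) y) + (1 / 4) * ‖lerayVorticity F s y‖ ^ 2 -
          ⟪lerayVorticity F s y, fderiv ℝ (lerayOrbit F s) y (lerayVorticity F s y)⟫ = 0 :=
        congrFun hev y
      linarith
    refine eq_zero_of_stretchingBalance_le_of_opNorm_lt heq ?_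
    have hDU := norm_fderiv_lerayOrbit_le_decay hF hD1 s y
    -- wait: `hD1` carries its own constant `C₁`; use instead the class-uniform `K₁`
    have hK := hK₁ hF hdF (-Real.exp (-s)) (neg_neg_of_pos (Real.exp_pos _)) (Real.exp (-s / 2) • y)
    rw [norm_iteratedFDeriv_one, neg_neg, sqrt_exp_neg, norm_smul,
      Real.norm_of_nonneg (Real.exp_pos _).le] at hK
    -- `‖DU(s,y)‖ = e^{-s}‖DV(t,x)‖ ≤ K₁ e^{-s}/(e^{-s/2}‖y‖ + e^{-s/2})² = K₁/(‖y‖+1)²`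
    have hpos : 0 < Real.exp (-s / 2) := Real.exp_pos _
    have hy0 : 0 ≤ ‖y‖ := norm_nonneg _
    have hden : 0 < (Real.exp (-s / 2) * ‖y‖ + Real.exp (-s / 2)) ^ (1 + 1) := by positivity
    have hDV : ‖fderiv ℝ (F (-Real.exp (-s))) (Real.exp (-s / 2) • y)‖ ≤
        K₁ / (Real.exp (-s / 2) * ‖y‖ + Real.exp (-s / 2)) ^ (1 + 1) := by
      rw [le_div_iff₀ hden, mul_comm]; exact hK
    rw [fderiv_lerayOrbit, norm_smul, Real.norm_of_nonneg (Real.exp_pos _).le]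
    have hee : Real.exp (-s / 2) * Real.exp (-s / 2) = Real.exp (-s) := by
      rw [← Real.exp_add]; congr 1; ring
    have e : K₁ / (Real.exp (-s / 2) * ‖y‖ + Real.exp (-s / 2)) ^ (1 + 1) =
        K₁ / (Real.exp (-s) * (‖y‖ + 1) ^ 2) := by
      congr 1
      rw [show Real.exp (-s / 2) * ‖y‖ + Real.exp (-s / 2) = Real.exp (-s / 2) * (‖y‖ + 1) by ring,
        mul_pow, ← hee]
      ring
    rw [e] at hDV
    have hy1 : 0 < (‖y‖ + 1) ^ 2 := by positivity
    calc Real.exp (-s) * ‖fderiv ℝ (F (-Real.exp (-s))) (Real.exp (-s / 2) • y)‖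
        ≤ Real.exp (-s) * (K₁ / (Real.exp (-s) * (‖y‖ + 1) ^ 2)) :=
          mul_le_mul_of_nonneg_left hDV (Real.exp_pos _).le
      _ = K₁ / (‖y‖ + 1) ^ 2 := by field_simp
      _ < 1 / 4 := by
          rw [div_lt_div_iff₀ hy1 (by norm_num : (0:ℝ) < 4)]
          have hsq : Real.sqrt K₁ ^ 2 = K₁ := Real.sq_sqrt hK₁0
          nlinarith [Real.sqrt_nonneg K₁]
  -- `F ≡ 0`
  have hcurl : ∀ t < 0, ∀ x, curl (F t) x = 0 := by
    intro t ht x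
    set s : ℝ := -Real.log (-t) with hs
    have hts : -Real.exp (-s) = t := by
      rw [hs, neg_neg, Real.exp_log (neg_pos.2 ht), neg_neg]
    have h := hΩ0 s ((Real.exp (-s / 2))⁻¹ • x)
    rw [lerayVorticity_apply, curl_lerayOrbit, smul_smul,
      mul_inv_cancel₀ (Real.exp_pos _).ne', one_smul, hts, smul_eq_zero] at h
    exact h.resolve_left (Real.exp_pos _).ne'
  have hconstF : ∀ t < 0, ∀ x, F t x = F t 0 := fun t ht x =>
    eq_of_curl_eq_zero_of_isDivFree_of_bounded ((hF.contDiff_slice ht).of_le (by norm_cast))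
      (hcurl t ht) (hF.isDivFree ht) (fun z => hF.norm_le ht z) x 0
  exact fun t ht x => hF.eq_zero_of_slice_const (b := fun t => F t 0) hconstF ht x


/-! ### Near the apex: a regularity criterion -/

/-- **THE STRETCHING BALANCE NEAR THE APEX IS A REGULARITY CRITERION (law-free).** A KNSS-gauge Type-I
field with a Type-I envelope and `⟪ω, ∇V ω⟫ ≤ |∇ω|²_F + ‖ω‖²/(4(−t))` on `[τ,0) × ℝ³` (some `τ < 0`) is
NOT singular at the apex. [folklore energy method + KNSS compactness] -/
theorem not_singular_of_stretchingBalance_near_apex (hV : IsTypeIAncientMild C V) (hdec : HasTypeIDecay C V)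
    {τ : ℝ} (hτ : τ < 0)
    (hP : ∀ t : ℝ, τ ≤ t → t < 0 → ∀ x, ⟪curl (V t) x, fderiv ℝ (V t) x (curl (V t) x)⟫ ≤
      frobeniusNormSq (fderiv ℝ (curl (V t)) x) + ‖curl (V t) x‖ ^ 2 / (4 * (-t))) :
    ¬ (∀ r > 0, ∀ M : ℝ, ∃ t ∈ Ioo (-(r ^ 2)) (0 : ℝ),
      ∃ x ∈ ball (0 : EuclideanSpace ℝ (Fin 3)) r, M < ‖V t x‖) := by
  have hP1 : ∀ t : ℝ, τ ≤ t → t < 0 → ∀ x, ⟪curl (V t) x, fderiv ℝ (V t) x (curl (V t) x)⟫ ≤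
      1 * (frobeniusNormSq (fderiv ℝ (curl (V t)) x) + ‖curl (V t) x‖ ^ 2 / (4 * (-t))) :=
    fun t h1 h2 x => by rw [one_mul]; exact hP t h1 h2 x
  exact not_singular_of_apex_scheme (C := C)
    (P := fun τ' F => ∀ t : ℝ, τ' ≤ t → t < 0 → ∀ x, ⟪curl (F t) x, fderiv ℝ (F t) x (curl (F t) x)⟫ ≤
      1 * (frobeniusNormSq (fderiv ℝ (curl (F t)) x) + ‖curl (F t) x‖ ^ 2 / (4 * (-t))))
    (Pinf := fun F => ∀ t < 0, ∀ x, ⟪curl (F t) x, fderiv ℝ (F t) x (curl (F t) x)⟫ ≤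
      1 * (frobeniusNormSq (fderiv ℝ (curl (F t)) x) + ‖curl (F t) x‖ ^ 2 / (4 * (-t))))
    (fun F c τ' hc hF => stretchingBalance_nsRescale_from hc hF)
    (fun u W τs hu _ hPu hτs hW hunif _ hgr => stretchingBalance_closed_eventually hu hW hunif hgr hPu hτs)
    (fun F τ' hF hdF hτ' hPF => antitoneOn_enstrophy_of_stretchingBalance_from hF hdF hτ' hPF)
    (fun F hF hdF hPF hc => eq_zero_of_stretchingBalance_of_enstrophy_const hF hdF hPF hc) hV hdec hτ hP1

/-- **PORTRAIT: the stretching excess accumulates at the apex.** A singular KNSS-gauge Type-I field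
(`IsTypeIAncientMild C V`, `C ≤ A`, `HasTypeIDecay A V`) has for every `τ < 0` a point `(t,x)` with
`τ ≤ t < 0` and `|∇ω|²_F + ‖ω‖²/(4(−t)) < ⟪ω, ∇V ω⟫`. [folklore energy method + KNSS compactness] -/
theorem stretching_excess_accumulates_of_singular {A : ℝ} (hV : IsTypeIAncientMild C V) (hCA : C ≤ A)
    (hdec : HasTypeIDecay A V)
    (hsing : ∀ r > 0, ∀ M : ℝ, ∃ t ∈ Ioo (-(r ^ 2)) (0 : ℝ),
        ∃ x ∈ ball (0 : EuclideanSpace ℝ (Fin 3)) r, M < ‖V t x‖)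
    {τ : ℝ} (hτ : τ < 0) :
    ∃ t : ℝ, τ ≤ t ∧ t < 0 ∧ ∃ x : EuclideanSpace ℝ (Fin 3),
      frobeniusNormSq (fderiv ℝ (curl (V t)) x) + ‖curl (V t) x‖ ^ 2 / (4 * (-t)) <
        ⟪curl (V t) x, fderiv ℝ (V t) x (curl (V t) x)⟫ := by
  by_contra h
  push Not at h
  exact not_singular_of_stretchingBalance_near_apex (isTypeIAncientMild_of_le hV hCA) hdec hτ
    (fun t h1 h2 x => h t h1 h2 x) hsing

/-! ### In the far past: a Liouville theorem -/

/-- **THE STRETCHING BALANCE IN THE FAR PAST FORCES `V ≡ 0` (law-free).** A KNSS-gauge Type-I field with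
a Type-I envelope and `⟪ω, ∇V ω⟫ ≤ |∇ω|²_F + ‖ω‖²/(4(−t))` on `(−∞,τ] × ℝ³` (some `τ < 0`) vanishes
identically. [folklore energy method + KNSS compactness] -/
theorem eq_zero_of_stretchingBalance_farPast (hV : IsTypeIAncientMild C V) (hdec : HasTypeIDecay C V)
    {τ : ℝ} (hτ : τ < 0)
    (hP : ∀ t : ℝ, t ≤ τ → t < 0 → ∀ x, ⟪curl (V t) x, fderiv ℝ (V t) x (curl (V t) x)⟫ ≤
      frobeniusNormSq (fderiv ℝ (curl (V t)) x) + ‖curl (V t) x‖ ^ 2 / (4 * (-t))) :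
    ∀ t < 0, ∀ x, V t x = 0 := by
  have hP1 : ∀ t : ℝ, t ≤ τ → t < 0 → ∀ x, ⟪curl (V t) x, fderiv ℝ (V t) x (curl (V t) x)⟫ ≤
      1 * (frobeniusNormSq (fderiv ℝ (curl (V t)) x) + ‖curl (V t) x‖ ^ 2 / (4 * (-t))) :=
    fun t h1 h2 x => by rw [one_mul]; exact hP t h1 h2 x
  exact eq_zero_of_farPast_scheme (C := C)
    (P := fun τ' F => ∀ t : ℝ, t ≤ τ' → t < 0 → ∀ x, ⟪curl (F t) x, fderiv ℝ (F t) x (curl (F t) x)⟫ ≤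
      1 * (frobeniusNormSq (fderiv ℝ (curl (F t)) x) + ‖curl (F t) x‖ ^ 2 / (4 * (-t))))
    (Pinf := fun F => ∀ t < 0, ∀ x, ⟪curl (F t) x, fderiv ℝ (F t) x (curl (F t) x)⟫ ≤
      1 * (frobeniusNormSq (fderiv ℝ (curl (F t)) x) + ‖curl (F t) x‖ ^ 2 / (4 * (-t))))
    (fun F c τ' hc hF => stretchingBalance_nsRescale_until hc hF)
    (fun u W τs hu _ hPu _ hτs hW hunif _ hgr => stretchingBalance_closed_eventually_until hu hW hunif hgr hPu hτs)
    (fun F τ' hF hdF hτ' hPF => antitoneOn_enstrophy_of_stretchingBalance_until hF hdF hτ' hPF)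
    (fun F hF hdF hPF hc => eq_zero_of_stretchingBalance_of_enstrophy_const hF hdF hPF hc) hV hdec hτ hP1

/-- **PORTRAIT: the stretching excess recedes into the far past** — a KNSS-gauge Type-I field
(`IsTypeIAncientMild C V`, `C ≤ A`, `HasTypeIDecay A V`) not identically zero on `t < 0` has for every
`τ < 0` a point with `t ≤ τ` and `|∇ω|²_F + ‖ω‖²/(4(−t)) < ⟪ω, ∇V ω⟫`. [folklore energy method + KNSS compactness] -/
theorem stretching_excess_recedes_of_ne_zero {A : ℝ} (hV : IsTypeIAncientMild C V) (hCA : C ≤ A)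
    (hdec : HasTypeIDecay A V) (hne : ∃ t : ℝ, t < 0 ∧ ∃ x, V t x ≠ 0) {τ : ℝ} (hτ : τ < 0) :
    ∃ t : ℝ, t ≤ τ ∧ t < 0 ∧ ∃ x : EuclideanSpace ℝ (Fin 3),
      frobeniusNormSq (fderiv ℝ (curl (V t)) x) + ‖curl (V t) x‖ ^ 2 / (4 * (-t)) <
        ⟪curl (V t) x, fderiv ℝ (V t) x (curl (V t) x)⟫ := by
  by_contra h
  push Not at h
  obtain ⟨t, ht, x, hx⟩ := hne
  exact hx (eq_zero_of_stretchingBalance_farPast (isTypeIAncientMild_of_le hV hCA) hdec hτ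
    (fun t' h1 h2 y => h t' h1 h2 y) t ht x)

end Summit.NavierStokesRegularity.NavierStokesRegularity.Theorems.FiniteDissipationLiouville.LocalBalance

end
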